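import Summits.Parity.BatemanHorn.Theorems.SelbergDelangeRigidityLSDRealSegmentTailsTwoPrintedEngineAux
import Summits.Parity.BatemanHorn.Theorems.SelbergDelangeRigidityLSDRealSegmentTailsTwoEnginePrep
import Summits.Parity.BatemanHorn.Theorems.SelbergDelangeRigidityLSDRealSegmentTailsTwoSparse
import Literature.NumberTheory.DiophantineApproximation.RidoutIntegers
import HarnessLib

/-!
# Route `SelbergDelangeRigidity`, crux `LSDRealSegment` (stmt-Parity-9770), line
# `product-anatomy-subcritical`: the small-prime restoration engine of `stub_tailsTwo`, RE-BASED on the printed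
# Nair–Tenenbaum Theorem 1, Bugeaud–Evertse–Győry discharged

THE ENGINE `tailsTwo_engine_printed` (registered helper): the landed `tailsTwo_engine` (content: see the module docstring
of `…TailsTwoEngine.lean`; proof verbatim) with its two named-fact hypotheses replaced by the single CORRECTED named fact
`NairTenenbaum1998_theorem1_printed` (Nair–Tenenbaum 1998, Thm 1 as printed: Henriot's form only on `0 < α < 1/2`; the
old `NairTenenbaum1998_theorem1` over-claims `α < 1`, Erratum 2 of `NairTenenbaumShortSums.lean`) — the engine only uses
`α = 1/4` (`tailsTwo_nt_uniform_printed`) — and with (R) `BugeaudEvertseGyory2018_SPartPolynomialValues` DISCHARGED by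
the tree's proof `BugeaudEvertseGyory2018_SPartPolynomialValues_holds` (fed to `tailsTwo_sparse`).
-/

open Filter Finset Polynomial
open scoped BigOperators Topology Classical

namespace Summit.Parity.BatemanHorn.Cruxes.LSDRealSegment.ProductAnatomySubcritical

open Literature.NumberTheory.Sieve
open Literature.NumberTheory.DiophantineApproximation
open ArithmeticFunction (cardFactors)
noncomputable section

set_option maxHeartbeats 1600000 in
/-- **tailsTwo_engine_printed** (registered helper of `stub_tailsTwo`, line `product-anatomy-subcritical`; CONDITIONAL on
the single named fact `NairTenenbaum1998_theorem1_printed`, Nair–Tenenbaum 1998 Thm 1 AS PRINTED, used at `α = 1/4`):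
the small-prime restoration engine — block sums of the full small-prime tilt times class-`𝓜(A,B,ε₁)` weights of the
`P`-rough parts, restricted to any set `𝒮` of smooth-part tuples, are `≤ C X (log X)^{−k} ∏ᵢ Hᵢ(2X) Z(𝒮) + X^{1−θ}`
(`θ = (1 − log₂ y)/6`, `ε₁ = (1 − log₂ y)/(9216 (k+1))`; see the module docstring).  Same proof as `tailsTwo_engine`,
with `tailsTwo_nt_uniform_printed` and `BugeaudEvertseGyory2018_SPartPolynomialValues_holds`. [folklore] -/
theorem tailsTwo_engine_printed : NairTenenbaum1998_theorem1_printed →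
    ∀ (k : ℕ) (f : Fin k → ℤ[X]), IsBatemanHornSystem f → (∑ i, (f i).natDegree) = 2 →
    ∀ (y A B : ℝ) (P : ℕ), 1 ≤ y → y < 2 → 1 ≤ A → 1 ≤ B →
    ∃ C : ℝ, ∃ X₀ : ℕ, 0 ≤ C ∧ ∀ (F : Fin k → ℕ → ℝ),
      (∀ i, IsClassM A B ((1 - Real.logb 2 y) / (9216 * (k + 1))) (F i)) →
      (∀ i m, F i m = F i (roughPart (P : ℝ) m)) → (∀ i, F i 1 ≤ 1) →
      ∀ (𝒮 : (Fin k → ℕ) → Prop) (X : ℕ), X₀ ≤ X →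
        (∑ n ∈ (Finset.Ioc X (2 * X)).filter (fun n => 𝒮 (fun i => smoothPart (P : ℝ) (val f i n))),
            ∏ i, (y ^ cardFactors (smoothPart (P : ℝ) (val f i n)) * F i (val f i n))) ≤
          C * ((X : ℝ) / Real.log X ^ k) *
              (∏ i, ∑ m ∈ Finset.Icc 1 (2 * X), F i m * (polyRootCountMod ![f i] m : ℝ) / m) *
              (∑ s ∈ (Fintype.piFinset fun _ : Fin k => Finset.Icc 1 X).filter
                  (fun s => (∀ i, ∀ p ∈ (s i).primeFactors, p ≤ P) ∧ 𝒮 s),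
                y ^ cardFactors (∏ i, s i) *
                  (#((Finset.range (Finset.univ.lcm s * primorial P)).filter (fun r : ℕ =>
                      ∀ i, ((s i : ℕ) : ℤ) ∣ (f i).eval (r : ℤ) ∧ ∀ p ∈ Nat.primesLE P,
                        ¬ ((p ^ ((s i).factorization p + 1) : ℕ) : ℤ) ∣ (f i).eval (r : ℤ))) : ℝ) /
                  ((Finset.univ.lcm s * primorial P : ℕ) : ℝ)) +
            (X : ℝ) ^ (1 - (1 - Real.logb 2 y) / 6) := by
  intro hP k f hf hdeg y A B P hy hy2 hA hB
  -- parameters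
  set lam : ℝ := Real.logb 2 y with hlam
  have hlam1 : lam < 1 := by
    rw [hlam, Real.logb_lt_iff_lt_rpow one_lt_two (by linarith), Real.rpow_one]; exact hy2
  set θ : ℝ := (1 - lam) / 6 with hθdef
  have hθ : 0 < θ := by rw [hθdef]; linarith
  have hθ1 : θ ≤ 1 / 6 := by rw [hθdef]; linarith [Real.logb_nonneg one_lt_two hy]
  set ε₁ : ℝ := (1 - lam) / (9216 * (k + 1)) with hε₁def
  have hk0 : (0 : ℝ) ≤ k := Nat.cast_nonneg k
  have hε₁ : 0 < ε₁ := by rw [hε₁def]; exact div_pos (by linarith) (by positivity)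
  have hε₁θ : ε₁ ≤ θ / (2 * k + 2) := by
    rw [hε₁def, hθdef, div_div, div_le_div_iff₀ (by positivity) (by positivity)]; nlinarith
  have hε₁nt : ε₁ ≤ 1 / 4 * (θ / 8) / (12 * ((2 : ℕ) : ℝ) ^ 2) := by
    rw [hε₁def, hθdef, div_le_div_iff₀ (by positivity) (by positivity)]; push_cast; nlinarith
  have hk1 : 1 ≤ k := by
    by_contra h
    obtain rfl : k = 0 := by omega
    simp at hdeg
  have hy0 : 0 ≤ y := by linarith
  have hB0 : 0 ≤ B := by linarith
  have hBk : 1 ≤ B ^ k := one_le_pow₀ hB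
  obtain ⟨n₀, hn₀⟩ := exists_forall_one_le_eval hf
  set F₀ : ℤ[X] := ∏ i, f i with hF₀
  set HF : ℕ := (F₀.coeff 2).natAbs + (F₀.coeff 1).natAbs + (F₀.coeff 0).natAbs with hHF
  set D₀ : ℕ := primorial P ^ 2 * F₀.discr.natAbs with hD₀
  obtain ⟨c₀, Cnt, hc₀0, hCnt0, hNTu⟩ := tailsTwo_nt_uniform_printed hP k 2 D₀ A (B ^ k) (1 / 4) (θ / 8) ε₁ hk1 hA hBk
    (by norm_num) (by norm_num) (by positivity) (by linarith) hε₁ hε₁nt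
  obtain ⟨Kπ, hKπ0, hKπ⟩ := prod_one_sub_rootCount_rescale_le hf P
  obtain ⟨X₁, hX₁⟩ := tailsTwo_sparse BugeaudEvertseGyory2018_SPartPolynomialValues_holds k f hf hdeg y θ ε₁ B P hy hy2
    hθ le_rfl hε₁ hε₁θ hB0
  set Pr : ℝ := (primorial P : ℝ) with hPr
  have hPr1 : 1 ≤ Pr := by rw [hPr]; exact_mod_cast primorial_pos P
  set cH : ℝ := c₀ * (4 * (HF : ℝ)) ^ (θ / 8) with hcH
  have hcH0 : 0 ≤ cH := by positivity
  obtain ⟨X₀, hX₀⟩ := tailsTwo_engine_eventually θ cH Pr hθ X₁ n₀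
  set C : ℝ := Cnt * (Kπ * (2 / θ) ^ k) with hC
  refine ⟨C, X₀, by positivity, ?_⟩
  intro F hF hFr hF1 𝒮 X hX
  obtain ⟨hXX₁, hXn₀, hX2, hXθ, hXθ4, hXlog⟩ := hX₀ X hX
  have hXr : (2 : ℝ) ≤ X := by exact_mod_cast hX2
  have hXpos : (0 : ℝ) < X := by linarith
  have hlogX : 0 < Real.log X := Real.log_pos (by linarith)
  have hF0 : ∀ i m, 0 ≤ F i m := fun i m => (hF i).1 m
  have hFB : ∀ i m, 1 ≤ m → F i m ≤ B * (m : ℝ) ^ ε₁ := by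
    intro i m hm
    have h := (hF i).2 m 1 hm le_rfl (Nat.coprime_one_right m)
    rw [mul_one] at h
    calc F i m ≤ min (A ^ (cardFactors m)) (B * (m : ℝ) ^ ε₁) * F i 1 := h
      _ ≤ (B * (m : ℝ) ^ ε₁) * 1 := mul_le_mul (min_le_right _ _) (hF1 i) (hF0 i 1) (by positivity)
      _ = B * (m : ℝ) ^ ε₁ := mul_one _
  set T : ℝ := (X : ℝ) ^ (1 - θ) with hT
  have hTX : T ≤ X := by
    calc T = (X : ℝ) ^ (1 - θ) := rfl
      _ ≤ (X : ℝ) ^ (1 : ℝ) := Real.rpow_le_rpow_of_exponent_le (by linarith) (by linarith)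
      _ = X := Real.rpow_one _
  set sp : ℕ → Fin k → ℕ := fun n i => smoothPart (P : ℝ) (val f i n) with hsp
  set W : ℕ → ℝ := fun n => ∏ i, (y ^ cardFactors (smoothPart (P : ℝ) (val f i n)) * F i (val f i n)) with hW
  set G : ℕ → ℝ := fun n => ∏ i, F i (val f i n) with hG
  have hW0 : ∀ n, 0 ≤ W n := fun n => Finset.prod_nonneg fun i _ => mul_nonneg (pow_nonneg hy0 _) (hF0 i _)
  have hG0 : ∀ n, 0 ≤ G n := fun n => Finset.prod_nonneg fun i _ => hF0 i _
  have hWG : ∀ n, W n = (∏ i, y ^ cardFactors (sp n i)) * G n := fun n => Finset.prod_mul_distrib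
  set S := Finset.Ioc X (2 * X) with hS
  set H : ℝ := ∏ i, ∑ m ∈ Finset.Icc 1 (2 * X), F i m * (polyRootCountMod ![f i] m : ℝ) / m with hH
  have hH0 : 0 ≤ H := Finset.prod_nonneg fun i _ => Finset.sum_nonneg fun m _ =>
    div_nonneg (mul_nonneg (hF0 i _) (Nat.cast_nonneg _)) (Nat.cast_nonneg _)
  set Λ : ℝ := Cnt * (Kπ * (2 / θ) ^ k / Real.log X ^ k) * H with hΛ
  have hΛ0 : 0 ≤ Λ := by positivity
  -- (1) ONE CLASS through Nair–Tenenbaum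
  have hclass : ∀ s : Fin k → ℕ, (∀ i, s i ≠ 0) → (∀ i, ∀ p ∈ (s i).primeFactors, p ≤ P) →
      ((Finset.univ.lcm s : ℕ) : ℝ) ≤ T → ∀ r : ℕ, r < Finset.univ.lcm s * primorial P →
      (∀ i, ((s i : ℕ) : ℤ) ∣ (f i).eval (r : ℤ) ∧
        ∀ p ∈ Nat.primesLE P, ¬ ((p ^ ((s i).factorization p + 1) : ℕ) : ℤ) ∣ (f i).eval (r : ℤ)) →
      ∑ n ∈ S.filter (fun n => n % (Finset.univ.lcm s * primorial P) = r), G n ≤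
        (X : ℝ) / (Finset.univ.lcm s * primorial P : ℕ) * Λ := by
    intro s hs1 hsP hLT r hrM hrE
    set M : ℕ := Finset.univ.lcm s * primorial P with hM
    have hM0 : 0 < M := by omega
    have hMr : (0 : ℝ) < M := by exact_mod_cast hM0
    have hMle : (M : ℝ) ≤ T * Pr := by
      rw [hM, Nat.cast_mul]
      exact mul_le_mul_of_nonneg_right hLT (by positivity)
    -- the length `ℓ = X/M ≥ X^θ/P# ≥ 16`
    set ℓ : ℝ := (X : ℝ) / M with hℓ
    have hℓ16 : 16 ≤ ℓ := by
      rw [hℓ, le_div_iff₀ hMr]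
      have h1 : (X : ℝ) = (X : ℝ) ^ θ * T := by rw [hT, ← Real.rpow_add hXpos]; norm_num
      calc 16 * (M : ℝ) ≤ 16 * (T * Pr) := by nlinarith
        _ = (16 * Pr) * T := by ring
        _ ≤ (X : ℝ) ^ θ * T := mul_le_mul_of_nonneg_right hXθ (by positivity)
        _ = X := h1.symm
    have hMX : (M : ℝ) ≤ X := by
      have : (1 : ℝ) ≤ ℓ := by linarith
      rwa [hℓ, le_div_iff₀ hMr, one_mul] at this
    have hrX : r ≤ X := by
      have : (r : ℝ) ≤ X := le_trans (by exact_mod_cast hrM.le) hMX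
      exact_mod_cast this
    set xr : ℝ := ((X : ℝ) - r) / M with hxr
    have hxrℓ : ℓ - 1 ≤ xr ∧ xr ≤ ℓ := by
      rw [hxr, hℓ, sub_div]
      have h1 : (r : ℝ) / M ≤ 1 := by rw [div_le_one hMr]; exact_mod_cast hrM.le
      have h2 : 0 ≤ (r : ℝ) / M := by positivity
      constructor <;> linarith
    have hxr0 : 0 ≤ xr := by linarith
    obtain ⟨hI1, hI2, hI3, hI4⟩ := nt_intervals_admissible hℓ16 hxrℓ.1 hxrℓ.2
    obtain ⟨Q, hQ, hirr, hcop, hfix, hdegQ, hdiscQ, hHQ, hρ0, hρ1, hρle, -, hvalQ⟩ :=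
      tailsTwo_class_system k f hf hdeg s P r hs1 hsP hrE
    -- re-index the class as a `t`-interval and split it
    rw [sum_filter_mod_eq_sum_Ioc hM0 hrM hrX (by omega) G]
    have e2X : (((2 * X : ℕ) : ℝ) - r) / M = xr + ℓ := by rw [hxr, hℓ]; push_cast; ring
    rw [e2X, sum_Ioc_floor_split xr (by positivity : 0 ≤ ℓ) (fun t => G (r + M * t))]
    have hNT1 : ∀ x : ℝ, xr ≤ x → x ≤ xr + ℓ / 2 → ℓ / 2 ≤ x → x ^ (1 / 4 : ℝ) < ℓ / 2 →
        ∑ t ∈ Finset.Ioc ⌊x⌋₊ ⌊x + ℓ / 2⌋₊, G (r + M * t) ≤ (ℓ / 2) * Λ := by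
      intro x hx1 hx2 hx3 hx4
      have hx0 : 0 ≤ x := le_trans hxr0 hx1
      -- members of the half are `> X ≥ n₀`
      have hpos : ∀ t ∈ Finset.Ioc ⌊x⌋₊ ⌊x + ℓ / 2⌋₊, ∀ i, (1 : ℤ) ≤ (f i).eval ((r + M * t : ℕ) : ℤ) := by
        intro t ht i
        refine hn₀ _ (le_of_lt (lt_of_le_of_lt hXn₀ ?_)) i
        have h1 : ⌊x⌋₊ < t := (Finset.mem_Ioc.mp ht).1
        have h2 : xr < t := lt_of_le_of_lt hx1 ((Nat.floor_lt hx0).mp h1)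
        rw [hxr, div_lt_iff₀ hMr] at h2
        have : (X : ℝ) < r + M * t := by linarith
        exact_mod_cast this
      -- identify the summand with the Nair–Tenenbaum weight of the rescaled system
      have hGQ : ∀ t ∈ Finset.Ioc ⌊x⌋₊ ⌊x + ℓ / 2⌋₊, G (r + M * t) = ∏ j, F j (((Q j).eval (t : ℤ)).natAbs) ∧
          (∏ j, Q j).eval (t : ℤ) ≠ 0 := by
        intro t ht
        have hv : ∀ i, 0 < (Q i).eval (t : ℤ) ∧ val f i (r + M * t) = s i * ((Q i).eval (t : ℤ)).natAbs ∧
            F i (val f i (r + M * t)) = F i ((Q i).eval (t : ℤ)).natAbs := fun i =>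
          weight_val_eq_of_class (hpos t ht i) (hs1 i) (hsP i) (by rw [hvalQ i t]) (hFr i)
        refine ⟨Finset.prod_congr rfl fun i _ => (hv i).2.2, ?_⟩
        rw [eval_prod]
        exact Finset.prod_ne_zero_iff.mpr fun i _ => (hv i).1.ne'
      have hcls : IsClassMk k A (B ^ k) ε₁ (fun n : Fin k → ℕ => ∏ j, F j (n j)) := isClassMk_prod hA hB0 hF
      -- the hypotheses of the uniform theorem
      have hdisc' : |(∏ j, Q j).discr| ≤ (D₀ : ℤ) := by
        rw [hD₀]; push_cast; exact hdiscQ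
      have hheight : c₀ * (polyHeight (∏ j, Q j) : ℝ) ^ (θ / 8) ≤ x := by
        have h1 : (polyHeight (∏ j, Q j) : ℝ) ≤ 4 * HF * (X : ℝ) ^ 2 := by
          have h2 : ((polyHeight (∏ j, Q j) : ℕ) : ℝ) ≤ ((HF * (M + r) ^ 2 : ℕ) : ℝ) := by exact_mod_cast hHQ
          refine h2.trans ?_
          push_cast
          have : ((M : ℝ) + r) ^ 2 ≤ 4 * (X : ℝ) ^ 2 := by
            have hr' : (r : ℝ) ≤ X := by exact_mod_cast hrX
            nlinarith
          nlinarith [Nat.cast_nonneg (α := ℝ) HF]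
        have h3 : (polyHeight (∏ j, Q j) : ℝ) ^ (θ / 8) ≤ (4 * HF) ^ (θ / 8) * (X : ℝ) ^ (θ / 4) := by
          calc (polyHeight (∏ j, Q j) : ℝ) ^ (θ / 8) ≤ (4 * HF * (X : ℝ) ^ 2) ^ (θ / 8) :=
                Real.rpow_le_rpow (Nat.cast_nonneg _) h1 (by positivity)
            _ = (4 * HF) ^ (θ / 8) * ((X : ℝ) ^ 2) ^ (θ / 8) := Real.mul_rpow (by positivity) (by positivity)
            _ = (4 * HF) ^ (θ / 8) * (X : ℝ) ^ (θ / 4) := by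
                rw [← Real.rpow_natCast (X : ℝ) 2, ← Real.rpow_mul hXpos.le]; congr 1; push_cast; ring
        have h4 : cH * (X : ℝ) ^ (θ / 4) + 1 ≤ ℓ := by
          rw [hℓ, le_div_iff₀ hMr]
          have h5 : (1 : ℝ) ≤ (X : ℝ) ^ (θ / 4) := Real.one_le_rpow (by linarith) (by positivity)
          calc (cH * (X : ℝ) ^ (θ / 4) + 1) * M ≤ ((cH + 1) * (X : ℝ) ^ (θ / 4)) * (T * Pr) :=
                mul_le_mul (by nlinarith) hMle hMr.le (by positivity)
            _ = Pr * ((cH + 1) * (X : ℝ) ^ (θ / 4)) * T := by ring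
            _ ≤ (X : ℝ) ^ θ * T := mul_le_mul_of_nonneg_right hXθ4 (by positivity)
            _ = X := by rw [hT, ← Real.rpow_add hXpos]; norm_num
        calc c₀ * (polyHeight (∏ j, Q j) : ℝ) ^ (θ / 8) ≤ c₀ * ((4 * HF) ^ (θ / 8) * (X : ℝ) ^ (θ / 4)) :=
              mul_le_mul_of_nonneg_left h3 hc₀0
          _ = cH * (X : ℝ) ^ (θ / 4) := by rw [hcH]; ring
          _ ≤ ℓ - 1 := by linarith
          _ ≤ x := le_trans hxrℓ.1 hx1
      have hmain := hNTu Q hirr hcop hfix hdegQ hdisc' _ hcls x (ℓ / 2) hheight hx4 hx3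
      have hLHS : ∑ t ∈ Finset.Ioc ⌊x⌋₊ ⌊x + ℓ / 2⌋₊, G (r + M * t) =
          ∑ t ∈ (Finset.Ioc ⌊x⌋₊ ⌊x + ℓ / 2⌋₊).filter (fun t : ℕ => (∏ j, Q j).eval (t : ℤ) ≠ 0),
            (fun n : Fin k → ℕ => ∏ j, F j (n j)) (fun j => ((Q j).eval (t : ℤ)).natAbs) := by
        rw [Finset.filter_true_of_mem fun t ht => (hGQ t ht).2]
        exact Finset.sum_congr rfl fun t ht => (hGQ t ht).1
      rw [hLHS]
      refine hmain.trans ?_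
      -- the sieve product and the harmonic factor
      have hN2 : 2 ≤ ⌊x⌋₊ := by
        have : (2 : ℝ) ≤ x := by linarith
        exact Nat.le_floor (by exact_mod_cast this)
      have hNx : (⌊x⌋₊ : ℝ) ≤ 2 * X := by
        have h1 : (⌊x⌋₊ : ℝ) ≤ x := Nat.floor_le hx0
        have h2 : ℓ ≤ X := by
          rw [hℓ, div_le_iff₀ hMr]
          have : (1 : ℝ) ≤ M := by exact_mod_cast hM0
          nlinarith
        linarith [hxrℓ.2]
      have hNx' : ⌊x⌋₊ ≤ 2 * X := by exact_mod_cast hNx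
      have hprod := hKπ Q hρ0 hρ1 ⌊x⌋₊ hN2
      have hlogN : θ / 2 * Real.log X ≤ Real.log ⌊x⌋₊ := by
        have h1 : ℓ / 2 - 1 ≤ (⌊x⌋₊ : ℝ) := by linarith [Nat.lt_floor_add_one x]
        have h2 : (X : ℝ) ^ θ / (4 * Pr) ≤ ℓ / 2 - 1 := by
          have h3 : (X : ℝ) ^ θ / Pr ≤ ℓ := by
            rw [hℓ, div_le_div_iff₀ (by positivity) hMr]
            calc (X : ℝ) ^ θ * M ≤ (X : ℝ) ^ θ * (T * Pr) := mul_le_mul_of_nonneg_left hMle (by positivity)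
              _ = X * Pr := by rw [← mul_assoc, hT, ← Real.rpow_add hXpos]; norm_num
          have h4 : (X : ℝ) ^ θ / (4 * Pr) = ((X : ℝ) ^ θ / Pr) / 4 := by field_simp
          have h5 : 16 ≤ (X : ℝ) ^ θ / Pr := by rw [le_div_iff₀ (by positivity)]; linarith
          rw [h4]; linarith
        have h6 : Real.log ((X : ℝ) ^ θ / (4 * Pr)) = θ * Real.log X - Real.log (4 * Pr) := by
          rw [Real.log_div (by positivity) (by positivity), Real.log_rpow hXpos]
        have h7 : Real.log ((X : ℝ) ^ θ / (4 * Pr)) ≤ Real.log ⌊x⌋₊ :=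
          Real.log_le_log (by positivity) (h2.trans h1)
        linarith
      have hlogN0 : 0 < Real.log ⌊x⌋₊ := lt_of_lt_of_le (by positivity) hlogN
      have hprod' : ∏ p ∈ (Finset.Icc 1 ⌊x⌋₊).filter Nat.Prime, (1 - (polyRootCountMod Q p : ℝ) / p) ≤
          Kπ * (2 / θ) ^ k / Real.log X ^ k := by
        refine hprod.trans ?_
        rw [div_le_div_iff₀ (pow_pos hlogN0 k) (pow_pos hlogX k), mul_assoc]
        refine mul_le_mul_of_nonneg_left ?_ hKπ0.le
        rw [← mul_pow]
        exact pow_le_pow_left₀ hlogX.le (by rw [div_mul_eq_mul_div, le_div_iff₀ hθ]; linarith) k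
      have hsum := piFinset_sum_le_prod_sum (Q := Q) (f := f) hρle hF0 hNx'
      have hP0 : 0 ≤ ∏ p ∈ (Finset.Icc 1 ⌊x⌋₊).filter Nat.Prime, (1 - (polyRootCountMod Q p : ℝ) / p) :=
        Finset.prod_nonneg fun p hp => by
          have hp' := (Finset.mem_filter.mp hp).2
          have : (polyRootCountMod Q p : ℝ) ≤ p := by exact_mod_cast polyRootCountMod_le Q p
          rw [sub_nonneg, div_le_one (by exact_mod_cast hp'.pos)]; exact this
      have hS0 : 0 ≤ ∑ n ∈ (Fintype.piFinset fun _ : Fin k => Finset.Icc 1 ⌊x⌋₊).filter (fun n => ∏ j, n j ≤ ⌊x⌋₊),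
          (fun n : Fin k → ℕ => ∏ j, F j (n j)) n * ∏ j, ((polyRootCountMod ![Q j] (n j) : ℝ) / (n j)) :=
        Finset.sum_nonneg fun n _ => mul_nonneg (Finset.prod_nonneg fun j _ => hF0 j _)
          (Finset.prod_nonneg fun j _ => by positivity)
      calc Cnt * (ℓ / 2) * (∏ p ∈ (Finset.Icc 1 ⌊x⌋₊).filter Nat.Prime, (1 - (polyRootCountMod Q p : ℝ) / p)) *
            ∑ n ∈ (Fintype.piFinset fun _ : Fin k => Finset.Icc 1 ⌊x⌋₊).filter (fun n => ∏ j, n j ≤ ⌊x⌋₊),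
              (fun n : Fin k → ℕ => ∏ j, F j (n j)) n * ∏ j, ((polyRootCountMod ![Q j] (n j) : ℝ) / (n j))
          ≤ Cnt * (ℓ / 2) * (Kπ * (2 / θ) ^ k / Real.log X ^ k) * H :=
            mul_le_mul (mul_le_mul_of_nonneg_left hprod' (by positivity)) hsum hS0 (by positivity)
        _ = (ℓ / 2) * Λ := by rw [hΛ]; ring
    have h1 := hNT1 xr le_rfl (by linarith) hI1 hI2
    have h2 := hNT1 (xr + ℓ / 2) (by linarith) le_rfl hI3 hI4
    calc _ ≤ (ℓ / 2) * Λ + (ℓ / 2) * Λ := add_le_add h1 h2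
      _ = (X : ℝ) / M * Λ := by rw [hℓ]; ring
  -- (2) ONE SLICE: its classes
  have hslice : ∀ s : Fin k → ℕ, (∀ i, s i ≠ 0) → (∀ i, ∀ p ∈ (s i).primeFactors, p ≤ P) →
      ((Finset.univ.lcm s : ℕ) : ℝ) ≤ T →
      ∑ n ∈ S.filter (fun n => sp n = s), W n ≤
        (X : ℝ) * Λ * (y ^ cardFactors (∏ i, s i) *
          (#((Finset.range (Finset.univ.lcm s * primorial P)).filter (fun r : ℕ =>
            ∀ i, ((s i : ℕ) : ℤ) ∣ (f i).eval (r : ℤ) ∧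
        ∀ p ∈ Nat.primesLE P, ¬ ((p ^ ((s i).factorization p + 1) : ℕ) : ℤ) ∣ (f i).eval (r : ℤ))) : ℝ) /
          ((Finset.univ.lcm s * primorial P : ℕ) : ℝ)) := by
    intro s hs1 hsP hLT
    set M : ℕ := Finset.univ.lcm s * primorial P with hM
    have hM0 : 0 < M := Nat.pos_of_ne_zero (mul_ne_zero (univ_lcm_ne_zero hs1) (primorial_ne_zero P))
    have hMr : (0 : ℝ) < M := by exact_mod_cast hM0
    -- on the fibre the small-prime tilt is constant and the fibre lies in the slice
    have hfib : ∑ n ∈ S.filter (fun n => sp n = s), W n ≤ y ^ cardFactors (∏ i, s i) *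
        ∑ n ∈ S.filter (fun n : ℕ => ∀ i, ((s i : ℕ) : ℤ) ∣ (f i).eval (n : ℤ) ∧
        ∀ p ∈ Nat.primesLE P, ¬ ((p ^ ((s i).factorization p + 1) : ℕ) : ℤ) ∣ (f i).eval (n : ℤ)), G n := by
      rw [Finset.mul_sum]
      have hsub : S.filter (fun n => sp n = s) ⊆ S.filter (fun n : ℕ => ∀ i, ((s i : ℕ) : ℤ) ∣ (f i).eval (n : ℤ) ∧
        ∀ p ∈ Nat.primesLE P, ¬ ((p ^ ((s i).factorization p + 1) : ℕ) : ℤ) ∣ (f i).eval (n : ℤ)) := by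
        intro n hn
        rw [Finset.mem_filter] at hn ⊢
        refine ⟨hn.1, (slice_iff_smoothPart_eq hs1 hsP (hn₀ n ?_)).mpr fun i => congr_fun hn.2 i⟩
        have := (Finset.mem_Ioc.mp hn.1).1; omega
      refine (Finset.sum_le_sum_of_subset_of_nonneg hsub fun n _ _ => hW0 n).trans (Finset.sum_le_sum fun n hn => ?_)
      have hn' : sp n = s := by
        have hE' := (Finset.mem_filter.mp hn).2
        have hpos := hn₀ n (by have := (Finset.mem_Ioc.mp (Finset.mem_filter.mp hn).1).1; omega)
        exact funext ((slice_iff_smoothPart_eq hs1 hsP hpos).mp hE')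
      rw [hWG n, hn', Finset.prod_pow_eq_pow_sum, ← cardFactors_finset_prod _ _ fun i _ => hs1 i]
    refine hfib.trans ?_
    have hper := periodic_slice f s P
    have hdecomp : ∑ n ∈ S.filter (fun n : ℕ => ∀ i, ((s i : ℕ) : ℤ) ∣ (f i).eval (n : ℤ) ∧
        ∀ p ∈ Nat.primesLE P, ¬ ((p ^ ((s i).factorization p + 1) : ℕ) : ℤ) ∣ (f i).eval (n : ℤ)), G n =
        ∑ r ∈ (Finset.range M).filter (fun r : ℕ => ∀ i, ((s i : ℕ) : ℤ) ∣ (f i).eval (r : ℤ) ∧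
        ∀ p ∈ Nat.primesLE P, ¬ ((p ^ ((s i).factorization p + 1) : ℕ) : ℤ) ∣ (f i).eval (r : ℤ)),
          ∑ n ∈ S.filter (fun n => n % M = r), G n := by
      rw [← Finset.sum_fiberwise_of_maps_to (g := fun n => n % M) (t := (Finset.range M).filter (fun r : ℕ =>
        ∀ i, ((s i : ℕ) : ℤ) ∣ (f i).eval (r : ℤ) ∧
        ∀ p ∈ Nat.primesLE P, ¬ ((p ^ ((s i).factorization p + 1) : ℕ) : ℤ) ∣ (f i).eval (r : ℤ)))]
      · refine Finset.sum_congr rfl fun r hr => Finset.sum_congr ?_ fun _ _ => rfl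
        ext n
        simp only [Finset.mem_filter]
        constructor
        · rintro ⟨⟨h1, _⟩, h3⟩; exact ⟨h1, h3⟩
        · rintro ⟨h1, h3⟩
          refine ⟨⟨h1, ?_⟩, h3⟩
          have hEr := (Finset.mem_filter.mp hr).2
          rw [← h3, hper.map_mod_nat] at hEr
          exact hEr
      · intro n hn
        rw [Finset.mem_filter] at hn ⊢
        exact ⟨Finset.mem_range.mpr (Nat.mod_lt n hM0), by rw [hper.map_mod_nat]; exact hn.2⟩
    rw [hdecomp]
    have hcl := hclass s hs1 hsP hLT
    calc y ^ cardFactors (∏ i, s i) * ∑ r ∈ (Finset.range M).filter (fun r : ℕ => ∀ i, ((s i : ℕ) : ℤ) ∣ (f i).eval (r : ℤ) ∧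
        ∀ p ∈ Nat.primesLE P, ¬ ((p ^ ((s i).factorization p + 1) : ℕ) : ℤ) ∣ (f i).eval (r : ℤ)),
          ∑ n ∈ S.filter (fun n => n % M = r), G n
        ≤ y ^ cardFactors (∏ i, s i) * ∑ r ∈ (Finset.range M).filter (fun r : ℕ => ∀ i, ((s i : ℕ) : ℤ) ∣ (f i).eval (r : ℤ) ∧
        ∀ p ∈ Nat.primesLE P, ¬ ((p ^ ((s i).factorization p + 1) : ℕ) : ℤ) ∣ (f i).eval (r : ℤ)),
          (X : ℝ) / M * Λ :=
          mul_le_mul_of_nonneg_left (Finset.sum_le_sum fun r hr => hcl r (Finset.mem_range.mp (Finset.mem_filter.mp hr).1)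
            (Finset.mem_filter.mp hr).2) (pow_nonneg hy0 _)
      _ = _ := by rw [Finset.sum_const, nsmul_eq_mul]; simp only [div_eq_mul_inv]; ring
  -- (3) assemble: dense slices and sparse slices
  set 𝒯 := (Fintype.piFinset fun _ : Fin k => Finset.Icc 1 X).filter
    (fun s => (∀ i, ∀ p ∈ (s i).primeFactors, p ≤ P) ∧ 𝒮 s) with h𝒯
  set Sd := (S.filter fun n => 𝒮 (sp n)).filter (fun n => ((Finset.univ.lcm (sp n) : ℕ) : ℝ) ≤ T) with hSd
  have hdense : ∑ n ∈ Sd, W n ≤ (X : ℝ) * Λ * ∑ s ∈ 𝒯, y ^ cardFactors (∏ i, s i) *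
      (#((Finset.range (Finset.univ.lcm s * primorial P)).filter (fun r : ℕ =>
        ∀ i, ((s i : ℕ) : ℤ) ∣ (f i).eval (r : ℤ) ∧
        ∀ p ∈ Nat.primesLE P, ¬ ((p ^ ((s i).factorization p + 1) : ℕ) : ℤ) ∣ (f i).eval (r : ℤ))) : ℝ) /
      ((Finset.univ.lcm s * primorial P : ℕ) : ℝ) := by
    have hmaps : ∀ n ∈ Sd, sp n ∈ 𝒯 := by
      intro n hn
      rw [hSd, Finset.mem_filter, Finset.mem_filter] at hn
      obtain ⟨⟨hnS, h𝒮⟩, hle⟩ := hn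
      rw [h𝒯, Finset.mem_filter, Fintype.mem_piFinset]
      refine ⟨fun i => Finset.mem_Icc.mpr ⟨Nat.one_le_iff_ne_zero.mpr (smoothPart_ne_zero _ _), ?_⟩,
        fun i p hp => by exact_mod_cast le_of_mem_primeFactors_smoothPart hp, h𝒮⟩
      have h1 : sp n i ≤ Finset.univ.lcm (sp n) := Nat.le_of_dvd (Nat.pos_of_ne_zero (univ_lcm_ne_zero
        fun j => smoothPart_ne_zero _ _)) (dvd_univ_lcm (sp n) i)
      have : (sp n i : ℝ) ≤ X := le_trans (by exact_mod_cast h1) (hle.trans hTX)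
      exact_mod_cast this
    rw [← Finset.sum_fiberwise_of_maps_to hmaps, Finset.mul_sum]
    refine Finset.sum_le_sum fun s hs => ?_
    rw [h𝒯, Finset.mem_filter, Fintype.mem_piFinset] at hs
    have hs1 : ∀ i, s i ≠ 0 := fun i => by have := (Finset.mem_Icc.mp (hs.1 i)).1; omega
    by_cases hLT : ((Finset.univ.lcm s : ℕ) : ℝ) ≤ T
    · refine le_trans ?_ (hslice s hs1 hs.2.1 hLT)
      refine Finset.sum_le_sum_of_subset_of_nonneg (fun n hn => ?_) fun n _ _ => hW0 n
      rw [Finset.mem_filter] at hn ⊢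
      exact ⟨(Finset.mem_filter.mp (Finset.mem_filter.mp hn.1).1).1, hn.2⟩
    · have : Sd.filter (fun n => sp n = s) = ∅ := by
        refine Finset.filter_false_of_mem fun n hn hns => hLT ?_
        rw [hSd, Finset.mem_filter] at hn
        rw [← hns]; exact hn.2
      rw [this, Finset.sum_empty]
      exact mul_nonneg (by positivity) (div_nonneg (mul_nonneg (pow_nonneg hy0 _) (Nat.cast_nonneg _)) (Nat.cast_nonneg _))
  have hsparse : ∑ n ∈ (S.filter fun n => 𝒮 (sp n)).filter (fun n => ¬ ((Finset.univ.lcm (sp n) : ℕ) : ℝ) ≤ T), W n ≤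
      (X : ℝ) ^ (1 - θ) := by
    refine le_trans (Finset.sum_le_sum_of_subset_of_nonneg (fun n hn => ?_) fun n _ _ => hW0 n)
      (hX₁ F hF0 hFB X (2 * X) hXX₁ (by omega) le_rfl)
    rw [Finset.mem_filter, Finset.mem_filter] at hn
    rw [Finset.mem_filter]
    exact ⟨hn.1.1, not_le.mp hn.2⟩
  rw [← Finset.sum_filter_add_sum_filter_not (S.filter fun n => 𝒮 (sp n))
    (fun n => ((Finset.univ.lcm (sp n) : ℕ) : ℝ) ≤ T) W]
  refine add_le_add (hdense.trans (le_of_eq ?_)) hsparse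
  rw [hC, hΛ]; simp only [div_eq_mul_inv]; ring

end

end Summit.Parity.BatemanHorn.Cruxes.LSDRealSegment.ProductAnatomySubcritical
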